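import Literature.RepresentationTheory.WeightSpaceTensorCoordinates
import Mathlib.RingTheory.TensorProduct.MvPolynomial
import Mathlib.RingTheory.Flat.Basic
import Mathlib.LinearAlgebra.Basis.VectorSpace
import HarnessLib

/-!
# Joint eigenvectors of a two-factor action: `(E_A ⊗ N) ∩ (M ⊗ E_B) = E_A ⊗ E_B`, and the polynomial tensor model

Topic `RepresentationTheory`; namespace `Literature.RepresentationTheory`.  Continuation of
`WeightSpaceTensorCoordinates` (operators through the FIRST factor of `M ⊗ N`).  Over a field `K`:

* §1 the right-factor version (`mem_range_lTensor_jointEigenspace_of_forall_eq_smul`, by `TensorProduct.comm`);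
* §2 **two-sided**: if `z ∈ M ⊗ N` is a joint eigenvector of a family `A_t ⊗ id` (eigenvalues `a_t`) AND of a family
  `id ⊗ B_s` (eigenvalues `b_s`), then `z ∈ E_A ⊗ E_B := range (E_A.subtype ⊗ E_B.subtype)`, `E_A`, `E_B` the joint
  eigenspaces (`mem_range_map_jointEigenspace`); proof: §1 inside `M ⊗ E_B`, using the injectivity of `id ⊗ E_B.subtype`
  (flatness over a field, Mathlib `Module.Flat.lTensor_preserves_injective_linearMap`);
* §3 the POLYNOMIAL tensor model (Mathlib `MvPolynomial.tensorEquivSum : K[X_σ] ⊗ K[X_ι] ≃ₐ K[X_{σ ⊕ ι}]`):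
  `tensorEquivSum (p ⊗ q) = rename inl p * rename inr q`, and an algebra endomorphism acting as `φ₁` on the
  `σ`-variables and as `φ₂` on the `ι`-variables (`sumMap φ₁ φ₂`) is `Algebra.TensorProduct.map φ₁ φ₂` transported
  (`sumMap_tensorEquivSum`); hence (§4) a polynomial in `K[X_{σ ⊕ ι}]` which is a joint eigenvector of endomorphisms
  of the first kind (`sumMap (φ₁ g) id`) and of the second kind (`sumMap id (φ₂ h)`) is a finite sum of products
  `rename inl p * rename inr q` of joint eigenvectors `p`, `q` of the factors (`mem_span_mul_of_isotypic`).

This is the bookkeeping "the `χ₁χ₂`-isotypic part of `V₁ ⊗ V₂` under `G₁ × G₂` acting factorwise is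
`V₁^{χ₁} ⊗ V₂^{χ₂}`" (Goodman–Wallach GTM 255 §4.2.1 on outer tensor products; folklore linear algebra), written for
polynomial rings so that per-place classifications of isotypic Fock polynomials (tree
`ClassicalInvariants/VectorCovectorUnitaryInvariants`, `SegalBargmann/FockRowDeterminantIsotypic`) assemble over several
places.  Everything is proved from Mathlib; no cited fact.

Provenance: LEAN-IN-TREE rule (2026-08-18), pub-hodgecm model-construction sub-cell, seat mc-binder-2 gen 5; KERNEL only.
[folklore]
-/

noncomputable section

open scoped TensorProduct

namespace Literature.RepresentationTheory

/-! ## §1  Operators through the second factor -/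

section Right

variable {K : Type*} [Field K] {M N : Type*} [AddCommGroup M] [Module K M] [AddCommGroup N] [Module K N]

/-- **Joint eigenvectors of a family `id ⊗ B_s` lie in `M ⊗ (joint eigenspace)`** (over a field). [folklore] -/
theorem mem_range_lTensor_jointEigenspace_of_forall_eq_smul {S : Type*} (B : S → Module.End K N) (b : S → K)
    {z : M ⊗[K] N} (hz : ∀ s, (B s).lTensor M z = b s • z) :
    z ∈ LinearMap.range ((jointEigenspace B b).subtype.lTensor M) := by
  have hz' : ∀ s, (B s).rTensor M (TensorProduct.comm K M N z) = b s • TensorProduct.comm K M N z := fun s => by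
    rw [LinearMap.rTensor_comm, hz s, map_smul]
  obtain ⟨y, hy⟩ := mem_range_rTensor_jointEigenspace_of_forall_eq_smul B b hz'
  have hcomm : ∀ v : M ⊗[K] N, TensorProduct.comm K N M (TensorProduct.comm K M N v) = v := fun v => by
    induction v using TensorProduct.induction_on with
    | zero => simp only [map_zero]
    | tmul m n => simp only [TensorProduct.comm_tmul]
    | add v w hv hw => simp only [map_add, hv, hw]
  refine ⟨TensorProduct.comm K _ M y, ?_⟩
  rw [LinearMap.lTensor_comm, hy, hcomm]

end Right

/-! ## §2  Two-sided: `E_A ⊗ E_B` -/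

section TwoSided

variable {K : Type*} [Field K] {M N : Type*} [AddCommGroup M] [Module K M] [AddCommGroup N] [Module K N]

/-- **A joint eigenvector of both families `A_t ⊗ id` and `id ⊗ B_s` lies in `E_A ⊗ E_B`** — the range of
`E_A.subtype ⊗ E_B.subtype`. [folklore] -/
theorem mem_range_map_jointEigenspace {T S : Type*} (A : T → Module.End K M) (a : T → K)
    (B : S → Module.End K N) (b : S → K) {z : M ⊗[K] N}
    (hA : ∀ t, (A t).rTensor N z = a t • z) (hB : ∀ s, (B s).lTensor M z = b s • z) :
    z ∈ LinearMap.range (TensorProduct.map (jointEigenspace A a).subtype (jointEigenspace B b).subtype) := by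
  -- first `z ∈ M ⊗ E_B`
  obtain ⟨y, rfl⟩ := mem_range_lTensor_jointEigenspace_of_forall_eq_smul B b hB
  -- the operators `A t ⊗ id` act on `M ⊗ E_B` compatibly, and `id ⊗ E_B.subtype` is injective (flatness)
  have hinj : Function.Injective ((jointEigenspace B b).subtype.lTensor M) :=
    Module.Flat.lTensor_preserves_injective_linearMap _ (Submodule.injective_subtype _)
  have hcomm : ∀ (t) (w : M ⊗[K] ↥(jointEigenspace B b)),
      (jointEigenspace B b).subtype.lTensor M ((A t).rTensor _ w) =
        (A t).rTensor N ((jointEigenspace B b).subtype.lTensor M w) := fun t w => by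
    induction w using TensorProduct.induction_on with
    | zero => simp only [map_zero]
    | tmul m n => simp only [LinearMap.lTensor_tmul, LinearMap.rTensor_tmul]
    | add w₁ w₂ h₁ h₂ => simp only [map_add, h₁, h₂]
  have hy : ∀ t, (A t).rTensor (jointEigenspace B b) y = a t • y := fun t =>
    hinj (by rw [hcomm, hA t, map_smul])
  have hmap : ∀ w : ↥(jointEigenspace A a) ⊗[K] ↥(jointEigenspace B b),
      TensorProduct.map (jointEigenspace A a).subtype (jointEigenspace B b).subtype w =
        (jointEigenspace B b).subtype.lTensor M ((jointEigenspace A a).subtype.rTensor _ w) := fun w => by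
    induction w using TensorProduct.induction_on with
    | zero => simp only [map_zero]
    | tmul m n => simp only [TensorProduct.map_tmul, LinearMap.lTensor_tmul, LinearMap.rTensor_tmul]
    | add w₁ w₂ h₁ h₂ => simp only [map_add, h₁, h₂]
  obtain ⟨x, rfl⟩ := mem_range_rTensor_jointEigenspace_of_forall_eq_smul A a hy
  exact ⟨x, hmap x⟩

/-- The range of `E_A.subtype ⊗ E_B.subtype` is the span of the pure tensors `x ⊗ y`, `x ∈ E_A`, `y ∈ E_B`. [folklore] -/
theorem range_map_subtype_eq_span (P : Submodule K M) (Q : Submodule K N) :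
    LinearMap.range (TensorProduct.map P.subtype Q.subtype) =
      Submodule.span K {z | ∃ x ∈ P, ∃ y ∈ Q, z = x ⊗ₜ[K] y} := by
  refine le_antisymm ?_ (Submodule.span_le.mpr ?_)
  · rintro _ ⟨w, rfl⟩
    induction w using TensorProduct.induction_on with
    | zero => rw [map_zero]; exact Submodule.zero_mem _
    | tmul x y => exact Submodule.subset_span ⟨x, x.2, y, y.2, by rw [TensorProduct.map_tmul]; rfl⟩
    | add w₁ w₂ h₁ h₂ => rw [map_add]; exact Submodule.add_mem _ h₁ h₂
  · rintro _ ⟨x, hx, y, hy, rfl⟩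
    exact ⟨⟨x, hx⟩ ⊗ₜ ⟨y, hy⟩, by rw [TensorProduct.map_tmul]; rfl⟩

/-- **Span form**: a two-sided joint eigenvector is a finite `K`-combination of pure tensors of joint eigenvectors.
[folklore] -/
theorem mem_span_tmul_of_forall_eq_smul {T S : Type*} (A : T → Module.End K M) (a : T → K)
    (B : S → Module.End K N) (b : S → K) {z : M ⊗[K] N}
    (hA : ∀ t, (A t).rTensor N z = a t • z) (hB : ∀ s, (B s).lTensor M z = b s • z) :
    z ∈ Submodule.span K {z | ∃ x ∈ jointEigenspace A a, ∃ y ∈ jointEigenspace B b, z = x ⊗ₜ[K] y} := by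
  rw [← range_map_subtype_eq_span]
  exact mem_range_map_jointEigenspace A a B b hA hB

end TwoSided

/-! ## §3  The polynomial tensor model `K[X_σ] ⊗ K[X_ι] ≃ K[X_{σ ⊕ ι}]` -/

section Poly

open MvPolynomial

variable {K : Type*} [CommRing K] {σ ι : Type*}

/-- `tensorEquivSum (p ⊗ 1) = rename inl p`. [folklore] -/
theorem tensorEquivSum_tmul_one (p : MvPolynomial σ K) :
    tensorEquivSum K σ ι K (p ⊗ₜ 1) = rename Sum.inl p := by
  have h : (tensorEquivSum K σ ι K).toAlgHom.comp Algebra.TensorProduct.includeLeft = rename Sum.inl :=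
    MvPolynomial.algHom_ext fun i => by simp [Algebra.TensorProduct.includeLeft_apply]
  exact AlgHom.congr_fun h p

/-- `tensorEquivSum (1 ⊗ q) = rename inr q`. [folklore] -/
theorem tensorEquivSum_one_tmul (q : MvPolynomial ι K) :
    tensorEquivSum K σ ι K (1 ⊗ₜ q) = rename Sum.inr q := by
  have h : (tensorEquivSum K σ ι K).toAlgHom.comp
      (Algebra.TensorProduct.includeRight : MvPolynomial ι K →ₐ[K] MvPolynomial σ K ⊗[K] MvPolynomial ι K) =
      rename Sum.inr :=
    MvPolynomial.algHom_ext fun j => by simp [Algebra.TensorProduct.includeRight_apply]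
  exact AlgHom.congr_fun h q

/-- **`tensorEquivSum (p ⊗ q) = rename inl p * rename inr q`.** [folklore] -/
theorem tensorEquivSum_tmul (p : MvPolynomial σ K) (q : MvPolynomial ι K) :
    tensorEquivSum K σ ι K (p ⊗ₜ q) = rename Sum.inl p * rename Sum.inr q := by
  have h : p ⊗ₜ[K] q = (p ⊗ₜ[K] (1 : MvPolynomial ι K)) * ((1 : MvPolynomial σ K) ⊗ₜ[K] q) := by
    rw [Algebra.TensorProduct.tmul_mul_tmul, mul_one, one_mul]
  rw [h, map_mul, tensorEquivSum_tmul_one, tensorEquivSum_one_tmul]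

/-- **The endomorphism of `K[X_{σ ⊕ ι}]` acting as `φ₁` on the `σ`-variables and as `φ₂` on the `ι`-variables.**
[folklore] -/
def sumMap (φ₁ : MvPolynomial σ K →ₐ[K] MvPolynomial σ K) (φ₂ : MvPolynomial ι K →ₐ[K] MvPolynomial ι K) :
    MvPolynomial (σ ⊕ ι) K →ₐ[K] MvPolynomial (σ ⊕ ι) K :=
  aeval (Sum.elim (fun i => rename Sum.inl (φ₁ (X i))) (fun j => rename Sum.inr (φ₂ (X j))))

/-- `sumMap φ₁ φ₂ (X (inl i)) = rename inl (φ₁ (X i))`. [folklore] -/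
@[simp] theorem sumMap_X_inl (φ₁ : MvPolynomial σ K →ₐ[K] MvPolynomial σ K)
    (φ₂ : MvPolynomial ι K →ₐ[K] MvPolynomial ι K) (i : σ) :
    sumMap φ₁ φ₂ (X (Sum.inl i)) = rename Sum.inl (φ₁ (X i)) := by
  rw [sumMap, aeval_X, Sum.elim_inl]

/-- `sumMap φ₁ φ₂ (X (inr j)) = rename inr (φ₂ (X j))`. [folklore] -/
@[simp] theorem sumMap_X_inr (φ₁ : MvPolynomial σ K →ₐ[K] MvPolynomial σ K)
    (φ₂ : MvPolynomial ι K →ₐ[K] MvPolynomial ι K) (j : ι) :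
    sumMap φ₁ φ₂ (X (Sum.inr j)) = rename Sum.inr (φ₂ (X j)) := by
  rw [sumMap, aeval_X, Sum.elim_inr]

/-- On `rename inl p` the map is `rename inl ∘ φ₁`. [folklore] -/
theorem sumMap_rename_inl (φ₁ : MvPolynomial σ K →ₐ[K] MvPolynomial σ K)
    (φ₂ : MvPolynomial ι K →ₐ[K] MvPolynomial ι K) (p : MvPolynomial σ K) :
    sumMap φ₁ φ₂ (rename Sum.inl p) = rename Sum.inl (φ₁ p) := by
  have h : (sumMap φ₁ φ₂).comp (rename Sum.inl) = (rename Sum.inl).comp φ₁ :=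
    MvPolynomial.algHom_ext fun i => by rw [AlgHom.comp_apply, rename_X, sumMap_X_inl, AlgHom.comp_apply]
  exact AlgHom.congr_fun h p

/-- On `rename inr q` the map is `rename inr ∘ φ₂`. [folklore] -/
theorem sumMap_rename_inr (φ₁ : MvPolynomial σ K →ₐ[K] MvPolynomial σ K)
    (φ₂ : MvPolynomial ι K →ₐ[K] MvPolynomial ι K) (q : MvPolynomial ι K) :
    sumMap φ₁ φ₂ (rename Sum.inr q) = rename Sum.inr (φ₂ q) := by
  have h : (sumMap φ₁ φ₂).comp (rename Sum.inr) = (rename Sum.inr).comp φ₂ :=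
    MvPolynomial.algHom_ext fun j => by rw [AlgHom.comp_apply, rename_X, sumMap_X_inr, AlgHom.comp_apply]
  exact AlgHom.congr_fun h q

/-- **`sumMap φ₁ φ₂` is `φ₁ ⊗ φ₂` in the tensor model.** [folklore] -/
theorem sumMap_tensorEquivSum (φ₁ : MvPolynomial σ K →ₐ[K] MvPolynomial σ K)
    (φ₂ : MvPolynomial ι K →ₐ[K] MvPolynomial ι K) (z : MvPolynomial σ K ⊗[K] MvPolynomial ι K) :
    sumMap φ₁ φ₂ (tensorEquivSum K σ ι K z) = tensorEquivSum K σ ι K (Algebra.TensorProduct.map φ₁ φ₂ z) := by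
  induction z using TensorProduct.induction_on with
  | zero => simp only [map_zero]
  | tmul p q =>
    rw [Algebra.TensorProduct.map_tmul, tensorEquivSum_tmul, tensorEquivSum_tmul, map_mul, sumMap_rename_inl,
      sumMap_rename_inr]
  | add z₁ z₂ h₁ h₂ => rw [map_add, map_add, h₁, h₂, map_add, map_add]

/-- First-factor action: `sumMap φ₁ id = tensorEquivSum ∘ (φ₁ ⊗ id) ∘ tensorEquivSum⁻¹`, linear-map form.
[folklore] -/
theorem sumMap_id_right_eq_rTensor (φ₁ : MvPolynomial σ K →ₐ[K] MvPolynomial σ K) (z : MvPolynomial σ K ⊗[K] MvPolynomial ι K) :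
    sumMap φ₁ (AlgHom.id K _) (tensorEquivSum K σ ι K z) =
      tensorEquivSum K σ ι K (φ₁.toLinearMap.rTensor (MvPolynomial ι K) z) := by
  rw [sumMap_tensorEquivSum]
  rfl

/-- Second-factor action: `sumMap id φ₂ = tensorEquivSum ∘ (id ⊗ φ₂) ∘ tensorEquivSum⁻¹`. [folklore] -/
theorem sumMap_id_left_eq_lTensor (φ₂ : MvPolynomial ι K →ₐ[K] MvPolynomial ι K) (z : MvPolynomial σ K ⊗[K] MvPolynomial ι K) :
    sumMap (AlgHom.id K _) φ₂ (tensorEquivSum K σ ι K z) =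
      tensorEquivSum K σ ι K (φ₂.toLinearMap.lTensor (MvPolynomial σ K) z) := by
  rw [sumMap_tensorEquivSum]
  rfl

end Poly

/-! ## §4  Isotypic polynomials for a two-factor action: sums of products -/

section PolyIsotypic

open MvPolynomial

variable {K : Type*} [Field K] {σ ι : Type*}

/-- **Joint eigenvectors in `K[X_{σ ⊕ ι}]` of endomorphisms acting on the `σ`-variables (`sumMap (φ₁ t) id`,
eigenvalues `a t`) and on the `ι`-variables (`sumMap id (φ₂ s)`, eigenvalues `b s`) are finite sums of products
`rename inl p * rename inr q`** of joint eigenvectors `p` of the `φ₁ t` and `q` of the `φ₂ s`. [folklore] -/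
theorem mem_span_mul_of_isotypic {T S : Type*} (φ₁ : T → (MvPolynomial σ K →ₐ[K] MvPolynomial σ K)) (a : T → K)
    (φ₂ : S → (MvPolynomial ι K →ₐ[K] MvPolynomial ι K)) (b : S → K) {F : MvPolynomial (σ ⊕ ι) K}
    (hA : ∀ t, sumMap (φ₁ t) (AlgHom.id K _) F = a t • F) (hB : ∀ s, sumMap (AlgHom.id K _) (φ₂ s) F = b s • F) :
    F ∈ Submodule.span K {F | ∃ p ∈ jointEigenspace (fun t => (φ₁ t).toLinearMap) a,
      ∃ q ∈ jointEigenspace (fun s => (φ₂ s).toLinearMap) b, F = rename Sum.inl p * rename Sum.inr q} := by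
  set e := tensorEquivSum K σ ι K with he
  set z := e.symm F with hz
  have hF : F = e z := (e.apply_symm_apply F).symm
  have hA' : ∀ t, (φ₁ t).toLinearMap.rTensor (MvPolynomial ι K) z = a t • z := fun t => by
    apply e.injective
    rw [← sumMap_id_right_eq_rTensor, ← hF, hA t, map_smul, ← hF]
  have hB' : ∀ s, (φ₂ s).toLinearMap.lTensor (MvPolynomial σ K) z = b s • z := fun s => by
    apply e.injective
    rw [← sumMap_id_left_eq_lTensor, ← hF, hB s, map_smul, ← hF]
  have hz' := mem_span_tmul_of_forall_eq_smul _ a _ b hA' hB'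
  rw [hF]
  -- push the span through `e`
  have himg : (e.toLinearEquiv.toLinearMap : _ →ₗ[K] _) '' {z | ∃ x ∈ jointEigenspace (fun t => (φ₁ t).toLinearMap) a,
        ∃ y ∈ jointEigenspace (fun s => (φ₂ s).toLinearMap) b, z = x ⊗ₜ[K] y} ⊆
      {F | ∃ p ∈ jointEigenspace (fun t => (φ₁ t).toLinearMap) a,
        ∃ q ∈ jointEigenspace (fun s => (φ₂ s).toLinearMap) b, F = rename Sum.inl p * rename Sum.inr q} := by
    rintro _ ⟨_, ⟨x, hx, y, hy, rfl⟩, rfl⟩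
    exact ⟨x, hx, y, hy, tensorEquivSum_tmul x y⟩
  have := Submodule.mem_map_of_mem (f := (e.toLinearEquiv.toLinearMap : _ →ₗ[K] _)) hz'
  rw [Submodule.map_span] at this
  exact Submodule.span_mono himg this

end PolyIsotypic

end Literature.RepresentationTheory

end
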